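import Literature.RepresentationTheory.HeisenbergGroup.SchrodingerSymplecticGenerators
import Literature.RepresentationTheory.HeisenbergGroup.SymplecticSiegelGeneration
import Mathlib.LinearAlgebra.GeneralLinearGroup.Basic
import HarnessLib

/-!
# Transport: Mathlib's matrix symplectic group → the coordinate-free `Sp(W)` of a Gram matrix `T`

For a commutative ring `K`, a finite index type `ι` and a matrix `T ∈ M_ι(K)` with `T.det` a unit, the space
`W = X × X`, `X = ι → K`, carries the duality `β_T(x, y) = x ⬝ᵥ (T *ᵥ y)` (Mathlib `Matrix.toLinearMap₂' K T`; the
polarisation used by the tree's adelic Heisenberg group `Heisenberg (polar β_T)` and by the embeddings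
`U(V) ↪ Sp(Res V)`), hence weil-1's coordinate-free symplectic group `symplecticGroup (polar β_T) ≤ GL(W)` of the
alternating form `β_T(x, y') - β_T(x', y)`.

The "Darboux" change of coordinates `(x, y) ↦ (x, T y) ∈ K^{ι ⊕ ι}` identifies this form with MINUS Mathlib's
`J`-form `u ⬝ᵥ (J *ᵥ u')`, `J = fromBlocks 0 (-1) 1 0`; so conjugation by it is a group homomorphism
**`transportSp T hT : Matrix.symplecticGroup ι K →* symplecticGroup (polar β_T)`** (`A ↦ P⁻¹ A P`), and it carries
the generators of `SymplecticSiegelGeneration` to weil-1's named elements: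

* `transportSp_levi  : transportSp (levi a)    = leviSp β_T (x ↦ a x) (y ↦ T⁻¹ a⁻ᵀ T y) _`,
* `transportSp_low   : transportSp (low c hc)  = unipotentSp β_T (x ↦ T⁻¹ c x) _`,
* `transportSp_J     : transportSp J           = weylSp β_T (y ↦ -T y) (x ↦ T⁻¹ x) _`.

With `SymplecticSiegelGeneration.eq_top_of_generators_mem'` this reduces any statement about the image of
`Sp_{2ι}(K)` (e.g. `K = F` a number field mapped into `K' = 𝔸_F`: the rational points) to the three families of
named elements, for which weil-1 / theta-1 / F2 / theta-2 supply implementers and Θ-invariance. Pure linear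
algebra; kernel only.
-/

open Matrix

noncomputable section

namespace Literature.RepresentationTheory.HeisenbergGroup.SymplecticMatrix

variable {K : Type*} [CommRing K] {ι : Type*} [Fintype ι] [DecidableEq ι]

/-! ## §1. Matrices as linear automorphisms of `ι → K` -/

/-- The linear automorphism `x ↦ A x` of `K^ι` attached to matrices `A`, `B` with `A B = 1 = B A` (inverse `x ↦ B x`).
[folklore] -/
def mulVecEquiv (A B : Matrix ι ι K) (hAB : A * B = 1) (hBA : B * A = 1) : (ι → K) ≃ₗ[K] (ι → K) where
  toFun x := A *ᵥ x
  map_add' x y := Matrix.mulVec_add A x y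
  map_smul' c x := Matrix.mulVec_smul A c x
  invFun x := B *ᵥ x
  left_inv x := by
    change B *ᵥ (A *ᵥ x) = x
    rw [Matrix.mulVec_mulVec, hBA, Matrix.one_mulVec]
  right_inv x := by
    change A *ᵥ (B *ᵥ x) = x
    rw [Matrix.mulVec_mulVec, hAB, Matrix.one_mulVec]

/-- `mulVecEquiv A B x = A x`. [folklore] -/
@[simp] theorem mulVecEquiv_apply (A B : Matrix ι ι K) (hAB : A * B = 1) (hBA : B * A = 1) (x : ι → K) :
    mulVecEquiv A B hAB hBA x = A *ᵥ x := rfl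

/-- `(mulVecEquiv A B).symm x = B x`. [folklore] -/
@[simp] theorem mulVecEquiv_symm_apply (A B : Matrix ι ι K) (hAB : A * B = 1) (hBA : B * A = 1) (x : ι → K) :
    (mulVecEquiv A B hAB hBA).symm x = B *ᵥ x := rfl

/-- `x ↦ a x` for `a ∈ GL_ι(K)`. [folklore] -/
def glEquiv (a : GL ι K) : (ι → K) ≃ₗ[K] (ι → K) :=
  mulVecEquiv (a : Matrix ι ι K) ((a⁻¹ : GL ι K) : Matrix ι ι K)
    (by rw [← Units.val_mul, mul_inv_cancel, Units.val_one]) (by rw [← Units.val_mul, inv_mul_cancel, Units.val_one])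

/-- `glEquiv a x = a x`. [folklore] -/
@[simp] theorem glEquiv_apply (a : GL ι K) (x : ι → K) : glEquiv a x = (a : Matrix ι ι K) *ᵥ x := rfl

/-- `(glEquiv a).symm x = a⁻¹ x`. [folklore] -/
@[simp] theorem glEquiv_symm_apply (a : GL ι K) (x : ι → K) :
    (glEquiv a).symm x = ((a⁻¹ : GL ι K) : Matrix ι ι K) *ᵥ x := rfl

section Gram

variable (T : Matrix ι ι K) (hT : IsUnit T.det)
include hT

/-- `y ↦ T y` (the Gram matrix as an automorphism, `T.det` a unit). [folklore] -/
def gramEquiv : (ι → K) ≃ₗ[K] (ι → K) :=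
  mulVecEquiv T T⁻¹ (Matrix.mul_nonsing_inv T hT) (Matrix.nonsing_inv_mul T hT)

/-- `gramEquiv T y = T y`. [folklore] -/
@[simp] theorem gramEquiv_apply (y : ι → K) : gramEquiv T hT y = T *ᵥ y := rfl

/-- `(gramEquiv T).symm x = T⁻¹ x`. [folklore] -/
@[simp] theorem gramEquiv_symm_apply (x : ι → K) : (gramEquiv T hT).symm x = T⁻¹ *ᵥ x := rfl

/-! ## §2. The Darboux coordinates `(x, y) ↦ (x, T y)` -/

/-- **Darboux coordinates**: `W = K^ι × K^ι ≃ K^{ι ⊕ ι}`, `(x, y) ↦ (x, T y)`; in them `β_T(x, y') - β_T(x', y)` is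
minus Mathlib's `J`-form (`alt_polar_eq_neg_jForm`). [folklore] -/
def darboux : ((ι → K) × (ι → K)) ≃ₗ[K] (ι ⊕ ι → K) where
  toFun v := Sum.elim v.1 (T *ᵥ v.2)
  map_add' v w := by
    funext i; rcases i with i | i
    · rfl
    · simp only [Prod.snd_add, Sum.elim_inr, Pi.add_apply, Matrix.mulVec_add]
  map_smul' c v := by
    funext i; rcases i with i | i
    · rfl
    · simp only [Prod.smul_snd, Sum.elim_inr, Pi.smul_apply, RingHom.id_apply, Matrix.mulVec_smul]
  invFun u := (u ∘ Sum.inl, T⁻¹ *ᵥ (u ∘ Sum.inr))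
  left_inv v := by
    ext1
    · rfl
    · change T⁻¹ *ᵥ (T *ᵥ v.2) = v.2
      rw [Matrix.mulVec_mulVec, Matrix.nonsing_inv_mul T hT, Matrix.one_mulVec]
  right_inv u := by
    funext i; rcases i with i | i
    · rfl
    · change (T *ᵥ (T⁻¹ *ᵥ (u ∘ Sum.inr))) i = u (Sum.inr i)
      rw [Matrix.mulVec_mulVec, Matrix.mul_nonsing_inv T hT, Matrix.one_mulVec]; rfl

/-- `darboux T (x, y) = Sum.elim x (T y)`. [folklore] -/
@[simp] theorem darboux_apply (v : (ι → K) × (ι → K)) : darboux T hT v = Sum.elim v.1 (T *ᵥ v.2) := rfl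

/-- `(darboux T)⁻¹ u = (u|₁, T⁻¹ u|₂)`. [folklore] -/
@[simp] theorem darboux_symm_apply (u : ι ⊕ ι → K) :
    (darboux T hT).symm u = (u ∘ Sum.inl, T⁻¹ *ᵥ (u ∘ Sum.inr)) := rfl

/-- `(darboux T)⁻¹ (Sum.elim a b) = (a, T⁻¹ b)`. [folklore] -/
@[simp] theorem darboux_symm_sumElim (a b : ι → K) : (darboux T hT).symm (Sum.elim a b) = (a, T⁻¹ *ᵥ b) := rfl

omit hT in
/-- **`β_T(x, y') - β_T(x', y) = -(u ⬝ᵥ J u')`** in Darboux coordinates `u = (x, T y)`, `u' = (x', T y')`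
(`J = fromBlocks 0 (-1) 1 0`). [folklore] -/
theorem alt_polar_eq_neg_jForm (v w : (ι → K) × (ι → K)) :
    alt (polar (Matrix.toLinearMap₂' K T)) v w =
      -(Sum.elim v.1 (T *ᵥ v.2) ⬝ᵥ (Matrix.J ι K *ᵥ Sum.elim w.1 (T *ᵥ w.2))) := by
  rw [alt_apply, polar_apply, polar_apply, Matrix.toLinearMap₂'_apply', Matrix.toLinearMap₂'_apply', Matrix.J,
    fromBlocks_mulVec, Sum.elim_comp_inl, Sum.elim_comp_inr, sumElim_dotProduct_sumElim, Matrix.zero_mulVec,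
    zero_add, Matrix.one_mulVec, Matrix.zero_mulVec, add_zero, Matrix.neg_mulVec, Matrix.one_mulVec,
    dotProduct_neg, dotProduct_comm (T *ᵥ v.2) w.1]
  ring

omit hT in
/-- **Symplectic matrices preserve the `J`-form** `u ⬝ᵥ (J u')` (Mathlib's `Aᵀ J A = J`). [folklore] -/
theorem jForm_mulVec (A : Matrix (ι ⊕ ι) (ι ⊕ ι) K) (hA : A ∈ Matrix.symplecticGroup ι K) (u u' : ι ⊕ ι → K) :
    (A *ᵥ u) ⬝ᵥ (Matrix.J ι K *ᵥ (A *ᵥ u')) = u ⬝ᵥ (Matrix.J ι K *ᵥ u') := by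
  rw [← Matrix.vecMul_transpose, ← dotProduct_mulVec, Matrix.mulVec_mulVec, Matrix.mulVec_mulVec,
    SymplecticGroup.mem_iff'.1 hA]

/-! ## §3. The transport homomorphism -/

/-- Conjugation by the Darboux coordinates, `A ↦ P⁻¹ ∘ A ∘ P`, as a monoid homomorphism
`M_{ι ⊕ ι}(K) →* End_K(W)`. [folklore] -/
def transportEnd : Matrix (ι ⊕ ι) (ι ⊕ ι) K →* Module.End K ((ι → K) × (ι → K)) where
  toFun A := ((darboux T hT).symm : (ι ⊕ ι → K) →ₗ[K] (ι → K) × (ι → K)) ∘ₗ Matrix.toLin' A ∘ₗ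
    ((darboux T hT) : ((ι → K) × (ι → K)) →ₗ[K] (ι ⊕ ι → K))
  map_one' := by
    apply LinearMap.ext; intro v
    simp only [Matrix.toLin'_one, LinearMap.coe_comp, LinearEquiv.coe_coe, Function.comp_apply, LinearMap.id_coe,
      id_eq, LinearEquiv.symm_apply_apply, Module.End.one_apply]
  map_mul' A B := by
    apply LinearMap.ext; intro v
    simp only [Matrix.toLin'_mul, LinearMap.coe_comp, LinearEquiv.coe_coe, Function.comp_apply,
      Module.End.mul_apply, LinearEquiv.apply_symm_apply]

/-- `transportEnd T A v = P⁻¹ (A (P v))`. [folklore] -/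
@[simp] theorem transportEnd_apply (A : Matrix (ι ⊕ ι) (ι ⊕ ι) K) (v : (ι → K) × (ι → K)) :
    transportEnd T hT A v = (darboux T hT).symm (A *ᵥ darboux T hT v) := by
  simp only [transportEnd, MonoidHom.coe_mk, OneHom.coe_mk, LinearMap.coe_comp, LinearEquiv.coe_coe,
    Function.comp_apply, Matrix.toLin'_apply]

/-- The transport on the symplectic group, valued in `GL(W) = W ≃ₗ[K] W`. [folklore] -/
def transportGL : Matrix.symplecticGroup ι K →* (((ι → K) × (ι → K)) ≃ₗ[K] ((ι → K) × (ι → K))) :=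
  (LinearMap.GeneralLinearGroup.generalLinearEquiv K ((ι → K) × (ι → K))).toMonoidHom.comp
    (((transportEnd T hT).comp (Matrix.symplecticGroup ι K).subtype).toHomUnits)

/-- `transportGL T g v = P⁻¹ (g (P v))`. [folklore] -/
@[simp] theorem transportGL_apply (g : Matrix.symplecticGroup ι K) (v : (ι → K) × (ι → K)) :
    transportGL T hT g v = (darboux T hT).symm ((g : Matrix (ι ⊕ ι) (ι ⊕ ι) K) *ᵥ darboux T hT v) := by
  change ((((transportEnd T hT).comp (Matrix.symplecticGroup ι K).subtype).toHomUnits g :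
    Module.End K ((ι → K) × (ι → K))) : _ → _) v = _
  rw [MonoidHom.coe_toHomUnits, MonoidHom.comp_apply, Submonoid.subtype_apply, transportEnd_apply]

/-- The transported automorphism preserves weil-1's alternating form `alt (polar β_T)`. [folklore] -/
theorem transportGL_mem_symplecticGroup (g : Matrix.symplecticGroup ι K) :
    transportGL T hT g ∈ symplecticGroup (polar (Matrix.toLinearMap₂' K T)) := by
  rw [symplecticGroup, Heisenberg.PseudoSymplectic.mem_isometries]
  intro v w
  rw [alt_polar_eq_neg_jForm, alt_polar_eq_neg_jForm, transportGL_apply, transportGL_apply]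
  have h1 : ∀ u : ι ⊕ ι → K, Sum.elim ((darboux T hT).symm u).1 (T *ᵥ ((darboux T hT).symm u).2) = u := fun u =>
    (darboux T hT).apply_symm_apply u
  rw [h1, h1, jForm_mulVec _ g.2]
  rfl

/-- **The transport homomorphism `Sp_{2ι}(K) →* Sp(W, β_T)`**: `A ↦ P⁻¹ A P` with `P (x, y) = (x, T y)`, from Mathlib's
matrix symplectic group to weil-1's coordinate-free symplectic group of the Gram matrix `T`. [folklore] -/
def transportSp : Matrix.symplecticGroup ι K →* symplecticGroup (polar (Matrix.toLinearMap₂' K T)) :=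
  (transportGL T hT).codRestrict _ (transportGL_mem_symplecticGroup T hT)

/-- `transportSp T g (x, y) = P⁻¹ (g (x, T y))`. [folklore] -/
@[simp] theorem coe_transportSp_apply (g : Matrix.symplecticGroup ι K) (v : (ι → K) × (ι → K)) :
    ((transportSp T hT g : symplecticGroup (polar (Matrix.toLinearMap₂' K T))) :
        ((ι → K) × (ι → K)) ≃ₗ[K] ((ι → K) × (ι → K))) v =
      (darboux T hT).symm ((g : Matrix (ι ⊕ ι) (ι ⊕ ι) K) *ᵥ darboux T hT v) := by
  change transportGL T hT g v = _
  rw [transportGL_apply]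

/-- The transport is injective. [folklore] -/
theorem transportSp_injective : Function.Injective (transportSp T hT) := by
  intro g g' h
  apply Subtype.ext
  have key : ∀ u : ι ⊕ ι → K, (g : Matrix (ι ⊕ ι) (ι ⊕ ι) K) *ᵥ u = (g' : Matrix (ι ⊕ ι) (ι ⊕ ι) K) *ᵥ u := by
    intro u
    have := congr_arg (fun s : symplecticGroup (polar (Matrix.toLinearMap₂' K T)) =>
      darboux T hT ((s : ((ι → K) × (ι → K)) ≃ₗ[K] ((ι → K) × (ι → K))) ((darboux T hT).symm u))) h
    simpa only [coe_transportSp_apply, LinearEquiv.apply_symm_apply] using this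
  ext i j
  simpa only [Matrix.mulVec_single_one, Matrix.col_apply] using congr_fun (key (Pi.single j 1)) i

/-! ## §4. The generators go to weil-1's named elements -/

omit hT in
/-- `a⁻ᵀ aᵀ = 1` for `a ∈ GL_ι(K)`. [folklore] -/
theorem transpose_inv_mul_transpose (a : GL ι K) :
    ((a⁻¹ : GL ι K) : Matrix ι ι K)ᵀ * (a : Matrix ι ι K)ᵀ = 1 := by
  rw [← transpose_mul, ← Units.val_mul, mul_inv_cancel, Units.val_one, transpose_one]

omit hT in
/-- `aᵀ a⁻ᵀ = 1` for `a ∈ GL_ι(K)`. [folklore] -/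
theorem transpose_mul_transpose_inv (a : GL ι K) :
    (a : Matrix ι ι K)ᵀ * ((a⁻¹ : GL ι K) : Matrix ι ι K)ᵀ = 1 := by
  rw [← transpose_mul, ← Units.val_mul, inv_mul_cancel, Units.val_one, transpose_one]

/-- The `Y`-component `y ↦ T⁻¹ a⁻ᵀ T y` of the transported Levi element `m(a)` (the contragredient of `a` read
through the duality `β_T`). [folklore] -/
def leviDual (a : GL ι K) : (ι → K) ≃ₗ[K] (ι → K) :=
  mulVecEquiv (T⁻¹ * ((a⁻¹ : GL ι K) : Matrix ι ι K)ᵀ * T) (T⁻¹ * (a : Matrix ι ι K)ᵀ * T)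
    (by
      simp only [Matrix.mul_assoc]
      rw [Matrix.mul_nonsing_inv_cancel_left T _ hT, ← Matrix.mul_assoc ((a⁻¹ : GL ι K) : Matrix ι ι K)ᵀ,
        transpose_inv_mul_transpose, Matrix.one_mul, Matrix.nonsing_inv_mul T hT])
    (by
      simp only [Matrix.mul_assoc]
      rw [Matrix.mul_nonsing_inv_cancel_left T _ hT, ← Matrix.mul_assoc (a : Matrix ι ι K)ᵀ,
        transpose_mul_transpose_inv, Matrix.one_mul, Matrix.nonsing_inv_mul T hT])

/-- `leviDual T a y = T⁻¹ a⁻ᵀ T y`. [folklore] -/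
@[simp] theorem leviDual_apply (a : GL ι K) (y : ι → K) :
    leviDual T hT a y = (T⁻¹ * ((a⁻¹ : GL ι K) : Matrix ι ι K)ᵀ * T) *ᵥ y := rfl

/-- `β_T(a x, T⁻¹ a⁻ᵀ T y) = β_T(x, y)`: the Levi pair `(a, leviDual a)` preserves the duality. [folklore] -/
theorem leviDual_compat (a : GL ι K) (x y : ι → K) :
    Matrix.toLinearMap₂' K T (glEquiv a x) (leviDual T hT a y) = Matrix.toLinearMap₂' K T x y := by
  rw [Matrix.toLinearMap₂'_apply', Matrix.toLinearMap₂'_apply', glEquiv_apply, leviDual_apply, Matrix.mulVec_mulVec,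
    Matrix.mul_assoc, Matrix.mul_nonsing_inv_cancel_left T _ hT, ← Matrix.mulVec_mulVec, dotProduct_mulVec,
    Matrix.vecMul_transpose, Matrix.mulVec_mulVec, ← Units.val_mul, inv_mul_cancel, Units.val_one, Matrix.one_mulVec]

/-- **`transportSp (m(a)) = leviSp β_T (x ↦ a x) (y ↦ T⁻¹ a⁻ᵀ T y)`** — the matrix Levi element goes to weil-1's Levi
element. [folklore] -/
theorem transportSp_levi (a : GL ι K) :
    transportSp T hT (levi a) =
      leviSp (Matrix.toLinearMap₂' K T) (glEquiv a) (leviDual T hT a) (leviDual_compat T hT a) := by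
  apply Subtype.ext
  apply LinearEquiv.ext
  intro v
  rw [coe_transportSp_apply, coe_leviSp_apply, coe_levi, darboux_apply, fromBlocks_mulVec, Sum.elim_comp_inl,
    Sum.elim_comp_inr, darboux_symm_sumElim, Matrix.zero_mulVec, Matrix.zero_mulVec, add_zero, zero_add,
    glEquiv_apply, leviDual_apply, Matrix.mulVec_mulVec, Matrix.mulVec_mulVec]

/-- The `X → Y` map `x ↦ T⁻¹ c x` of the transported opposite unipotent `v(c)`. [folklore] -/
def lowLin (c : Matrix ι ι K) : (ι → K) →ₗ[K] (ι → K) := Matrix.mulVecLin (T⁻¹ * c)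

omit hT in
/-- `lowLin T c x = T⁻¹ c x`. [folklore] -/
@[simp] theorem lowLin_apply (c : Matrix ι ι K) (x : ι → K) : lowLin T c x = (T⁻¹ * c) *ᵥ x := rfl

/-- `β_T(x, T⁻¹ c x') = x ⬝ᵥ c x'` is symmetric in `x, x'` for `c` symmetric. [folklore] -/
theorem lowLin_symm (c : Matrix ι ι K) (hc : c.IsSymm) (x x' : ι → K) :
    Matrix.toLinearMap₂' K T x (lowLin T c x') = Matrix.toLinearMap₂' K T x' (lowLin T c x) := by
  rw [Matrix.toLinearMap₂'_apply', Matrix.toLinearMap₂'_apply', lowLin_apply, lowLin_apply, Matrix.mulVec_mulVec,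
    Matrix.mulVec_mulVec, Matrix.mul_nonsing_inv_cancel_left T _ hT, dotProduct_mulVec, ← Matrix.mulVec_transpose,
    hc.eq, dotProduct_comm]

/-- **`transportSp (v(c)) = unipotentSp β_T (x ↦ T⁻¹ c x)`** — the matrix opposite unipotent `fromBlocks 1 0 c 1` goes to
weil-1's unipotent element `(x, y) ↦ (x, y + T⁻¹ c x)`. [folklore] -/
theorem transportSp_low [Invertible (2 : K)] (c : Matrix ι ι K) (hc : c.IsSymm) :
    transportSp T hT (low c hc) =
      unipotentSp (Matrix.toLinearMap₂' K T) (lowLin T c) (lowLin_symm T hT c hc) := by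
  apply Subtype.ext
  apply LinearEquiv.ext
  intro v
  rw [coe_transportSp_apply, coe_unipotentSp, unipotentσ_apply, coe_low, darboux_apply, fromBlocks_mulVec,
    Sum.elim_comp_inl, Sum.elim_comp_inr, darboux_symm_sumElim, Matrix.one_mulVec, Matrix.zero_mulVec, add_zero,
    Matrix.one_mulVec, Matrix.mulVec_add, Matrix.mulVec_mulVec, Matrix.mulVec_mulVec, Matrix.nonsing_inv_mul T hT,
    Matrix.one_mulVec, lowLin_apply, add_comm]

/-- The `Y ≃ X` part `y ↦ -T y` of the transported Weyl element. [folklore] -/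
def weylGamma : (ι → K) ≃ₗ[K] (ι → K) := (gramEquiv T hT).trans (LinearEquiv.neg K)

/-- `weylGamma T y = -(T y)`. [folklore] -/
@[simp] theorem weylGamma_apply (y : ι → K) : weylGamma T hT y = -(T *ᵥ y) := rfl

/-- `β_T(-T y, T⁻¹ x) = -β_T(x, y)`: weil-1's Weyl condition for `(γ, δ) = (-T·, T⁻¹·)`. [folklore] -/
theorem weylGamma_compat (x y : ι → K) :
    Matrix.toLinearMap₂' K T (weylGamma T hT y) ((gramEquiv T hT).symm x) = -Matrix.toLinearMap₂' K T x y := by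
  rw [Matrix.toLinearMap₂'_apply', Matrix.toLinearMap₂'_apply', weylGamma_apply, gramEquiv_symm_apply,
    Matrix.mulVec_mulVec, Matrix.mul_nonsing_inv T hT, Matrix.one_mulVec, neg_dotProduct, dotProduct_comm]

/-- **`transportSp J = weylSp β_T (y ↦ -T y) (x ↦ T⁻¹ x)`** — Mathlib's `J = fromBlocks 0 (-1) 1 0` goes to weil-1's Weyl
element `(x, y) ↦ (-T y, T⁻¹ x)`. [folklore] -/
theorem transportSp_J :
    transportSp T hT (SymplecticGroup.symJ ι K) =
      weylSp (Matrix.toLinearMap₂' K T) (weylGamma T hT) (gramEquiv T hT).symm (weylGamma_compat T hT) := by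
  apply Subtype.ext
  apply LinearEquiv.ext
  intro v
  rw [coe_transportSp_apply, coe_weylSp, weylσ_apply, SymplecticGroup.coe_J, Matrix.J, darboux_apply,
    fromBlocks_mulVec, Sum.elim_comp_inl, Sum.elim_comp_inr, darboux_symm_sumElim, Matrix.zero_mulVec, zero_add,
    Matrix.one_mulVec, Matrix.zero_mulVec, add_zero, Matrix.neg_mulVec, Matrix.one_mulVec, weylGamma_apply,
    gramEquiv_symm_apply]

/-! ## §5. Change of scalars and the consumable form -/

omit hT

/-- **Change of scalars** `Sp_{2ι}(K) →* Sp_{2ι}(K')` along a ring homomorphism `f` (entrywise; Mathlib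
`SymplecticGroup.map_mem`) — e.g. the rational points `F → 𝔸_F`. [folklore] -/
def mapHom {K' : Type*} [CommRing K'] (f : K →+* K') : Matrix.symplecticGroup ι K →* Matrix.symplecticGroup ι K' where
  toFun A := ⟨(A : Matrix (ι ⊕ ι) (ι ⊕ ι) K).map f, SymplecticGroup.map_mem A.2 f⟩
  map_one' := Subtype.ext (by simp only [OneMemClass.coe_one, Matrix.map_one, map_zero, map_one])
  map_mul' A B := Subtype.ext (by simp only [Submonoid.coe_mul, Matrix.map_mul])

/-- The matrix of `mapHom f A`. [folklore] -/
@[simp] theorem coe_mapHom {K' : Type*} [CommRing K'] (f : K →+* K') (A : Matrix.symplecticGroup ι K) :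
    ((mapHom f A : Matrix.symplecticGroup ι K') : Matrix (ι ⊕ ι) (ι ⊕ ι) K') = (A : Matrix (ι ⊕ ι) (ι ⊕ ι) K).map f :=
  rfl

/-- `mapHom f (m(a)) = m(f a)`. [folklore] -/
theorem mapHom_levi {K' : Type*} [CommRing K'] (f : K →+* K') (a : GL ι K) :
    mapHom f (levi a) = levi (Matrix.GeneralLinearGroup.map f a) := by
  apply Subtype.ext
  rw [coe_mapHom, coe_levi, coe_levi, Matrix.fromBlocks_map, Matrix.transpose_map, Matrix.map_zero _ (map_zero f)]
  rfl

/-- `mapHom f (n(b)) = n(f b)`. [folklore] -/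
theorem mapHom_unip {K' : Type*} [CommRing K'] (f : K →+* K') (b : Matrix ι ι K) (hb : b.IsSymm) :
    mapHom f (unip b hb) = unip (b.map f) (hb.map f) := by
  apply Subtype.ext
  rw [coe_mapHom, coe_unip, coe_unip, Matrix.fromBlocks_map, Matrix.map_zero _ (map_zero f),
    Matrix.map_one _ (map_zero f) (map_one f)]

/-- `mapHom f (v(c)) = v(f c)`. [folklore] -/
theorem mapHom_low {K' : Type*} [CommRing K'] (f : K →+* K') (c : Matrix ι ι K) (hc : c.IsSymm) :
    mapHom f (low c hc) = low (c.map f) (hc.map f) := by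
  apply Subtype.ext
  rw [coe_mapHom, coe_low, coe_low, Matrix.fromBlocks_map, Matrix.map_zero _ (map_zero f),
    Matrix.map_one _ (map_zero f) (map_one f)]

/-- `mapHom f J = J`. [folklore] -/
theorem mapHom_J {K' : Type*} [CommRing K'] (f : K →+* K') :
    mapHom f (SymplecticGroup.symJ ι K) = SymplecticGroup.symJ ι K' := by
  apply Subtype.ext
  rw [coe_mapHom, SymplecticGroup.coe_J, SymplecticGroup.coe_J, Matrix.map_J]

/-- **Consumable form (generation + transport).** Let `K` be a LOCAL commutative ring (e.g. a field `F`), `f : K →+* K'`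
(e.g. `F → 𝔸_F`), `T' ∈ M_ι(K')` with unit determinant and `2` invertible in `K'`. If a subgroup `L ≤ Sp(W', β_{T'})`
contains weil-1's Levi elements `leviSp (f a ·) (T'⁻¹ (f a)⁻ᵀ T' ·)` for all `a ∈ GL_ι(K)`, the unipotents
`unipotentSp (T'⁻¹ (f c) ·)` for all symmetric `c ∈ M_ι(K)`, and the Weyl element `weylSp (-T'·) (T'⁻¹·)`, then `L`
contains the whole image of `Sp_{2ι}(K)` — by `eq_top_of_generators_mem'` (Mathlib's big-cell lemma over local rings)
and §4. This is the shape in which "`Sp(W)(F) ≤` the Θ-liftable subgroup" is consumed. [folklore] -/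
theorem range_transportSp_mapHom_le [IsLocalRing K] {K' : Type*} [CommRing K'] [Invertible (2 : K')] (f : K →+* K')
    (T' : Matrix ι ι K') (hT' : IsUnit T'.det)
    {L : Subgroup (symplecticGroup (polar (Matrix.toLinearMap₂' K' T')))}
    (hm : ∀ a : GL ι K, leviSp (Matrix.toLinearMap₂' K' T') (glEquiv (Matrix.GeneralLinearGroup.map f a))
      (leviDual T' hT' (Matrix.GeneralLinearGroup.map f a)) (leviDual_compat T' hT' _) ∈ L)
    (hv : ∀ (c : Matrix ι ι K) (hc : c.IsSymm), unipotentSp (Matrix.toLinearMap₂' K' T') (lowLin T' (c.map f))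
      (lowLin_symm T' hT' (c.map f) (hc.map f)) ∈ L)
    (hw : weylSp (Matrix.toLinearMap₂' K' T') (weylGamma T' hT') (gramEquiv T' hT').symm (weylGamma_compat T' hT') ∈ L) :
    ((transportSp T' hT').comp (mapHom f)).range ≤ L := by
  rw [MonoidHom.range_eq_map, ← eq_top_of_generators_mem' (H := L.comap ((transportSp T' hT').comp (mapHom f)))]
  · exact Subgroup.map_comap_le _ _
  · intro a
    rw [Subgroup.mem_comap, MonoidHom.comp_apply, mapHom_levi, transportSp_levi]
    exact hm a
  · intro c hc
    rw [Subgroup.mem_comap, MonoidHom.comp_apply, mapHom_low, transportSp_low]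
    exact hv c hc
  · rw [Subgroup.mem_comap, MonoidHom.comp_apply, mapHom_J, transportSp_J]
    exact hw

end Gram

end Literature.RepresentationTheory.HeisenbergGroup.SymplecticMatrix

end
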